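import Summits.CriticalPhenomena.PercolationContinuityZ3.Theorems.PercNearOneGluingNoHeavyLowerTailSahiE3ExchangeJoin
import Mathlib.Tactic.Linarith
import Mathlib.Tactic.Ring
import Mathlib.Tactic.Positivity
import HarnessLib
import HarnessLib.Audit

/-!
# `NoHeavyLowerTail` (crux stmt-CriticalPhenomena-4575), Sahi programme P4: the FLOW-NORMAL 2×2 exchange lemma in the pure class — PROVED

Support file (cell `prim-l12`, seat P4, generation 28; `--supports stmt-CriticalPhenomena-4575`).  No named facts, no sorries;
standard axioms; def-free.

Context (HOME prim-l12-p4/FROM-prim-l12-p4-gen28-EXCHANGE-REFUTED.md).  Harris block `(B, w, V)` (`w ≥ 0` of mass `1`, slot `V`, `v = w(V)`,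
`a(X) = w(X∩V)`, `c(X) = w(X∖V)`, `need(X,Y) = x·a(Y) + y·a(X) − v·x·y`), PURE configuration `K ⊇ L`, `L' ⊇ K'`, `A = K∖L`, `A' = L'∖K'`,
crossing cell `Ξ = A∩A'∩V`.  Generation 28 REFUTED the certificate-free exchange lemma ("`EXCH(R) ≥ 0` for every `R ≥ 0` on `V`
satisfying all pair inequalities": exact Bool⁵ witnesses) and observed that the offending certificates are far from FLOW-NORMAL, whereas the
natural certificates of the programme satisfy `R ≤ (2−v)·w` (generations 19, 27).  This file PROVES the exchange lemma for every `R ≥ 0` on `V`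
that satisfies the four pair inequalities `(K,K')`, `(L,L')`, `(K,L')`, `(L,K')` and is flow-normal ON THE CROSSING CELL, `R(Ξ) ≤ (2−v)·w(Ξ)`
(`exchange_pure_flowNormal`).  Proof — a two-packing dichotomy with `β₀ := Har(K;K'_V) + Har(L';L_V) + (1−v)·Har(K,L') ≥ 0`:
* same-footprint packing: `EXCH ≥ same0 = β₀ + [w(Ξ) + c(A)c(A') − a(A)a(A')]` (`…ExchangeJoin`);
* cross packing with overflow (crossing identity of `…ExchangeCross` + flow-normality on `Ξ`):
  `EXCH ≥ T − (1−v)·w(Ξ) = β₀ + (1−v)·[w(A)w(A') − w(Ξ)]` (`exchange_pure_overflow`);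
and if the first bracket is negative then `w(Ξ) < a(A)a(A') − c(A)c(A') ≤ a(A)a(A') ≤ w(A)w(A')`, so the second is positive.  [this work]
-/

namespace Summit.CriticalPhenomena.PercolationContinuityZ3.Theorems.SahiE3ExchangeFlowNormal

open Finset SahiE3DimerPacking SahiE3ExchangeCross SahiE3ExchangeJoin
open scoped BigOperators

variable {B : Type*} [DecidableEq B]

/-- **Pure-class supply identity with the crossing cell.**  For `L ⊆ K`, `K' ⊆ L'` and any `R`:
`R(KK'V) + R(LL'V) + R(Ξ) = R(KL'V) + R(LK'V)`, `Ξ = (K∖L)∩(L'∖K')∩V` (the other cells of the crossing identity are empty). [this work] -/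
theorem supply_add_crossing_pure (R : B → ℝ) (V K L K' L' : Finset B) (hLK : L ⊆ K) (hK'L' : K' ⊆ L') :
    ∑ b ∈ (K ∩ K') ∩ V, R b + ∑ b ∈ (L ∩ L') ∩ V, R b + ∑ b ∈ ((K \ L) ∩ (L' \ K')) ∩ V, R b
      = ∑ b ∈ (K ∩ L') ∩ V, R b + ∑ b ∈ (L ∩ K') ∩ V, R b := by
  have key := exchange_cross_identity R V K L K' L'
  have e1 : ((L \ K) ∩ (K' \ L')) ∩ V = ∅ := by
    ext b; simp only [Finset.mem_inter, Finset.mem_sdiff, Finset.notMem_empty, iff_false]; tauto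
  have e2 : ((K \ L) ∩ (K' \ L')) ∩ V = ∅ := by
    ext b; simp only [Finset.mem_inter, Finset.mem_sdiff, Finset.notMem_empty, iff_false]
    rintro ⟨⟨_, hk', hl'⟩, _⟩; exact hl' (hK'L' hk')
  have e3 : ((L \ K) ∩ (L' \ K')) ∩ V = ∅ := by
    ext b; simp only [Finset.mem_inter, Finset.mem_sdiff, Finset.notMem_empty, iff_false]
    rintro ⟨⟨⟨hl, hk⟩, _⟩, _⟩; exact hk (hLK hl)
  rw [e1, e2, e3, Finset.sum_empty] at key
  linarith

/-- **Overflow bound (pure class).**  `R ≥ 0`... not even needed: ANY `R` with the CROSS pair inequalities `(K,L')`, `(L,K')` and flow-normal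
on the crossing cell, `R(Ξ) ≤ (2−v)·w(Ξ)`, gives `EXCH(R) ≥ T − (1−v)·w(Ξ)`, written here as
`0 ≤ EXCH(R) − [Har(K;K'_V) + Har(L';L_V) + (1−v)(Har(K,L') + (k−l)(l'−k')) − (1−v)·w(Ξ)]`. [this work] -/
theorem exchange_pure_overflow (w R : B → ℝ) (V K L K' L' : Finset B) (hLK : L ⊆ K) (hK'L' : K' ⊆ L')
    (hpair₁ : (∑ b ∈ K, w b) * (∑ b ∈ L' ∩ V, w b) + (∑ b ∈ L', w b) * (∑ b ∈ K ∩ V, w b)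
        - (∑ b ∈ V, w b) * (∑ b ∈ K, w b) * (∑ b ∈ L', w b) ≤ ∑ b ∈ (K ∩ L') ∩ V, R b)
    (hpair₂ : (∑ b ∈ L, w b) * (∑ b ∈ K' ∩ V, w b) + (∑ b ∈ K', w b) * (∑ b ∈ L ∩ V, w b)
        - (∑ b ∈ V, w b) * (∑ b ∈ L, w b) * (∑ b ∈ K', w b) ≤ ∑ b ∈ (L ∩ K') ∩ V, R b)
    (hflat : ∑ b ∈ ((K \ L) ∩ (L' \ K')) ∩ V, R b ≤ (2 - ∑ b ∈ V, w b) * ∑ b ∈ ((K \ L) ∩ (L' \ K')) ∩ V, w b) :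
    (∑ b ∈ (K ∩ K') ∩ V, w b) - (∑ b ∈ K, w b) * (∑ b ∈ K' ∩ V, w b)
        + ((∑ b ∈ (L ∩ L') ∩ V, w b) - (∑ b ∈ L', w b) * (∑ b ∈ L ∩ V, w b))
        + (1 - ∑ b ∈ V, w b) * (((∑ b ∈ K ∩ L', w b) - (∑ b ∈ K, w b) * (∑ b ∈ L', w b))
            + ((∑ b ∈ K, w b) - ∑ b ∈ L, w b) * ((∑ b ∈ L', w b) - ∑ b ∈ K', w b))
        - (1 - ∑ b ∈ V, w b) * ∑ b ∈ ((K \ L) ∩ (L' \ K')) ∩ V, w b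
      ≤ (∑ b ∈ (K ∩ L') ∩ V, w b) + (∑ b ∈ (L ∩ K') ∩ V, w b)
        - (∑ b ∈ K, w b) * (∑ b ∈ K' ∩ V, w b) - (∑ b ∈ L', w b) * (∑ b ∈ L ∩ V, w b)
        + (∑ b ∈ (K ∩ K') ∩ V, R b) + (∑ b ∈ (L ∩ L') ∩ V, R b)
        - ((∑ b ∈ K, w b) * (∑ b ∈ L' ∩ V, w b) + (∑ b ∈ L', w b) * (∑ b ∈ K ∩ V, w b)
            - (∑ b ∈ V, w b) * (∑ b ∈ K, w b) * (∑ b ∈ L', w b))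
        - ((∑ b ∈ L, w b) * (∑ b ∈ K' ∩ V, w b) + (∑ b ∈ K', w b) * (∑ b ∈ L ∩ V, w b)
            - (∑ b ∈ V, w b) * (∑ b ∈ L, w b) * (∑ b ∈ K', w b))
        + (1 - ∑ b ∈ V, w b) * (((∑ b ∈ K ∩ L', w b) - (∑ b ∈ K, w b) * (∑ b ∈ L', w b))
            + ((∑ b ∈ K, w b) - ∑ b ∈ L, w b) * ((∑ b ∈ L', w b) - ∑ b ∈ K', w b)) := by
  have hsup := supply_add_crossing_pure R V K L K' L' hLK hK'L'
  have hΞ := sum_cross_cell w V K L K' L' hLK hK'L'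
  nlinarith [hsup, hΞ, hpair₁, hpair₂, hflat]

/-- **The flow-normal 2×2 exchange lemma (pure class).**  `B` finite, `w ≥ 0` of total mass `1`, slot `V`, `L ⊆ K`, `K' ⊆ L'`; a weight
`R` satisfying the pair inequality at the four pairs `(K,K')`, `(L,L')`, `(K,L')`, `(L,K')` and flow-normal on the crossing cell
`Ξ = (K∖L)∩(L'∖K')∩V` (`R(Ξ) ≤ (2−v)·w(Ξ)`; e.g. every `R ≤ (2−v)·w` on `V`, in particular every natural certificate); and the Harris products
`Har(K;K'_V)`, `Har(L';L_V)`, `Har(K,L') ≥ 0`.  Then the pure-class exchange expression is `≥ 0`.  (The hypothesis on `Ξ` cannot be dropped: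
generation 28's exact Bool⁵ witnesses.) [this work] -/
theorem exchange_pure_flowNormal [Fintype B] (w R : B → ℝ) (hw : ∀ b, 0 ≤ w b) (hw1 : ∑ b, w b = 1)
    (V K L K' L' : Finset B) (hLK : L ⊆ K) (hK'L' : K' ⊆ L')
    (hpairK : (∑ b ∈ K, w b) * (∑ b ∈ K' ∩ V, w b) + (∑ b ∈ K', w b) * (∑ b ∈ K ∩ V, w b)
        - (∑ b ∈ V, w b) * (∑ b ∈ K, w b) * (∑ b ∈ K', w b) ≤ ∑ b ∈ (K ∩ K') ∩ V, R b)
    (hpairL : (∑ b ∈ L, w b) * (∑ b ∈ L' ∩ V, w b) + (∑ b ∈ L', w b) * (∑ b ∈ L ∩ V, w b)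
        - (∑ b ∈ V, w b) * (∑ b ∈ L, w b) * (∑ b ∈ L', w b) ≤ ∑ b ∈ (L ∩ L') ∩ V, R b)
    (hpair₁ : (∑ b ∈ K, w b) * (∑ b ∈ L' ∩ V, w b) + (∑ b ∈ L', w b) * (∑ b ∈ K ∩ V, w b)
        - (∑ b ∈ V, w b) * (∑ b ∈ K, w b) * (∑ b ∈ L', w b) ≤ ∑ b ∈ (K ∩ L') ∩ V, R b)
    (hpair₂ : (∑ b ∈ L, w b) * (∑ b ∈ K' ∩ V, w b) + (∑ b ∈ K', w b) * (∑ b ∈ L ∩ V, w b)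
        - (∑ b ∈ V, w b) * (∑ b ∈ L, w b) * (∑ b ∈ K', w b) ≤ ∑ b ∈ (L ∩ K') ∩ V, R b)
    (hflat : ∑ b ∈ ((K \ L) ∩ (L' \ K')) ∩ V, R b ≤ (2 - ∑ b ∈ V, w b) * ∑ b ∈ ((K \ L) ∩ (L' \ K')) ∩ V, w b)
    (hHarKK' : (∑ b ∈ K, w b) * (∑ b ∈ K' ∩ V, w b) ≤ ∑ b ∈ (K ∩ K') ∩ V, w b)
    (hHarL'L : (∑ b ∈ L', w b) * (∑ b ∈ L ∩ V, w b) ≤ ∑ b ∈ (L ∩ L') ∩ V, w b)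
    (hHar₄ : (∑ b ∈ K, w b) * (∑ b ∈ L', w b) ≤ ∑ b ∈ K ∩ L', w b) :
    0 ≤ (∑ b ∈ (K ∩ L') ∩ V, w b) + (∑ b ∈ (L ∩ K') ∩ V, w b)
        - (∑ b ∈ K, w b) * (∑ b ∈ K' ∩ V, w b) - (∑ b ∈ L', w b) * (∑ b ∈ L ∩ V, w b)
        + (∑ b ∈ (K ∩ K') ∩ V, R b) + (∑ b ∈ (L ∩ L') ∩ V, R b)
        - ((∑ b ∈ K, w b) * (∑ b ∈ L' ∩ V, w b) + (∑ b ∈ L', w b) * (∑ b ∈ K ∩ V, w b)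
            - (∑ b ∈ V, w b) * (∑ b ∈ K, w b) * (∑ b ∈ L', w b))
        - ((∑ b ∈ L, w b) * (∑ b ∈ K' ∩ V, w b) + (∑ b ∈ K', w b) * (∑ b ∈ L ∩ V, w b)
            - (∑ b ∈ V, w b) * (∑ b ∈ L, w b) * (∑ b ∈ K', w b))
        + (1 - ∑ b ∈ V, w b) * (((∑ b ∈ K ∩ L', w b) - (∑ b ∈ K, w b) * (∑ b ∈ L', w b))
            + ((∑ b ∈ K, w b) - ∑ b ∈ L, w b) * ((∑ b ∈ L', w b) - ∑ b ∈ K', w b)) := by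
  -- names
  set v := ∑ b ∈ V, w b with hv
  set k := ∑ b ∈ K, w b with hk
  set l := ∑ b ∈ L, w b with hl
  set k' := ∑ b ∈ K', w b with hk'
  set l' := ∑ b ∈ L', w b with hl'
  set aK := ∑ b ∈ K ∩ V, w b with haK
  set aL := ∑ b ∈ L ∩ V, w b with haL
  set aK' := ∑ b ∈ K' ∩ V, w b with haK'
  set aL' := ∑ b ∈ L' ∩ V, w b with haL'
  set wΞ := ∑ b ∈ ((K \ L) ∩ (L' \ K')) ∩ V, w b with hwΞ
  -- masses of the differences: a(A) = aK − aL ≤ k − l, a(A') = aL' − aK' ≤ l' − k'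
  have hv1 : v ≤ 1 := by rw [hv, ← hw1]; exact sum_le_sum_of_subset' w hw (Finset.subset_univ V)
  have hcA : 0 ≤ (k - l) - (aK - aL) := by
    have h1 : ∑ b ∈ (K \ L) ∩ V, w b ≤ ∑ b ∈ K \ L, w b := sum_le_sum_of_subset' w hw Finset.inter_subset_left
    have h2 : ∑ b ∈ K \ L, w b = k - l := Finset.sum_sdiff_eq_sub hLK
    have h3 : ∑ b ∈ (K \ L) ∩ V, w b = aK - aL := sum_sdiff_inter w V K L hLK
    linarith
  have hcA' : 0 ≤ (l' - k') - (aL' - aK') := by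
    have h1 : ∑ b ∈ (L' \ K') ∩ V, w b ≤ ∑ b ∈ L' \ K', w b := sum_le_sum_of_subset' w hw Finset.inter_subset_left
    have h2 : ∑ b ∈ L' \ K', w b = l' - k' := Finset.sum_sdiff_eq_sub hK'L'
    have h3 : ∑ b ∈ (L' \ K') ∩ V, w b = aL' - aK' := sum_sdiff_inter w V L' K' hK'L'
    linarith
  have haA : 0 ≤ aK - aL := by
    have h3 : ∑ b ∈ (K \ L) ∩ V, w b = aK - aL := sum_sdiff_inter w V K L hLK
    have h0 : 0 ≤ ∑ b ∈ (K \ L) ∩ V, w b := Finset.sum_nonneg fun b _ => hw b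
    linarith
  have haA' : 0 ≤ aL' - aK' := by
    have h3 : ∑ b ∈ (L' \ K') ∩ V, w b = aL' - aK' := sum_sdiff_inter w V L' K' hK'L'
    have h0 : 0 ≤ ∑ b ∈ (L' \ K') ∩ V, w b := Finset.sum_nonneg fun b _ => hw b
    linarith
  rcases le_or_gt ((aK - aL) * (aL' - aK') - ((k - l) - (aK - aL)) * ((l' - k') - (aL' - aK'))) wΞ with h1 | h2
  · -- Case 1: same-footprint packing.  same0 = H₁ + H₂ + v̄C + [wΞ + c c' − a a'] ≥ 0.
    have hA : ∑ b ∈ (K \ L) ∩ V, w b = aK - aL := sum_sdiff_inter w V K L hLK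
    have hA' : ∑ b ∈ (L' \ K') ∩ V, w b = aL' - aK' := sum_sdiff_inter w V L' K' hK'L'
    have hΞ := sum_cross_cell w V K L K' L' hLK hK'L'
    have hvC : 0 ≤ (1 - v) * ((∑ b ∈ K ∩ L', w b) - k * l') := mul_nonneg (by linarith) (by linarith)
    linarith [hpairK, hpairL, hHarKK', hHarL'L, h1, hvC, hΞ]
  · -- Case 2: cross packing with overflow.  wΞ < a a' − c c' ≤ a a' ≤ (k−l)(l'−k'), so T − v̄·wΞ ≥ β₀ ≥ 0.
    have hover := exchange_pure_overflow w R V K L K' L' hLK hK'L' hpair₁ hpair₂ hflat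
    have hcc : 0 ≤ ((k - l) - (aK - aL)) * ((l' - k') - (aL' - aK')) := mul_nonneg hcA hcA'
    have haa : (aK - aL) * (aL' - aK') ≤ (k - l) * (l' - k') :=
      mul_le_mul (by linarith) (by linarith) haA' (by linarith)
    have hPP : wΞ ≤ (k - l) * (l' - k') := by linarith
    have hvPP : 0 ≤ (1 - v) * ((k - l) * (l' - k') - wΞ) := mul_nonneg (by linarith) (by linarith)
    have hvC : 0 ≤ (1 - v) * ((∑ b ∈ K ∩ L', w b) - k * l') := mul_nonneg (by linarith) (by linarith)
    linarith [hover, hHarKK', hHarL'L, hvPP, hvC]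

end Summit.CriticalPhenomena.PercolationContinuityZ3.Theorems.SahiE3ExchangeFlowNormal
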